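import Summits.PneNP.PneNP.Theorems.ConvexRankGatesCaptureRingSpanProgramGate
import Mathlib.GroupTheory.PGroup
import HarnessLib

/-!
# Crux `Capture` (stmt-PneNP-2659), line `csp-spine-meet-to-join` — stub
# `stub_pGroupCaptureOfJuntaCompleteness` (p-group COSET gates from completeness of the scope-junta span program)

Skeleton rev 6 (lead c2) of line `csp-spine-meet-to-join` for the crux
`Summit.PneNP.PneNP.Theses.ConvexRankGates.Capture` isolates the CONJECTURE `PGroupJuntaCompleteness`:
for a finite `p`-group `G`, a system of selected coset constraints "`h ∘ scope j ∈ c j · H j`" over `G`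
has no common solution only if some `(0, t)`, `t ≠ 0`, lies in the additive closure (over `ℤ/|G|`) of
the selected relation blocks `R j` of the SCOPE-JUNTA span program — `R j` is the set of all pairs
`(w, b)`, `w` indexed by the features `⟨j', α⟩` ("`h ∘ scope j' = α`"), such that
`∑ w ⟨j', α⟩ · [h ∘ scope j' = α] = b` for EVERY `h` satisfying constraint `j` alone. This file proves the
hypothesis-passing reduction registered as `stub_pGroupCaptureOfJuntaCompleteness`: ASSUMING that
completeness, every `p`-group COSET gate of size parameter `s` is computed by a monotone circuit of
size `≤ (s + 2) ^ 4` over `permBasis ((s + 2) ^ 4)`. The span program is SOUND unconditionally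
(`juntaSpan_sound`: a common solution `h` gives the evaluation functional
`(w, b) ↦ ∑ w · [feature holds at h] - b`, which kills every selected generator, hence the closure, hence
`t`), so under the hypothesis the gate fires iff the ring span program accepts, and the landed plumbing
lemma `ring_span_program_cktSize` (`Theorems/ConvexRankGatesCaptureRingSpanProgramGate.lean`) turns it
into `≤ 2|G| + 1` gates of `permBasis S` for `|G| (#features + 1) ≤ S`; the count
`#features = ∑ j |G| ^ (r j) ≤ s · s` gives `S = (s + 2) ^ 4`. 2026-08-16. [folklore]
-/

namespace Summit.PneNP.PneNP.Cruxes.Capture.CspSpineMeetToJoin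

set_option linter.dupNamespace false -- `Summit.PneNP.PneNP.…`: summit = sub-problem (D-0017)

open Literature.Computability.Complexity

/-- **Soundness of the scope-junta span program.** If every selected block `R j` consists of affine
relations `∑ w · feat = b` valid at a fixed feature vector `feat` (the features of a common solution),
then `(0, t)` lies in the additive closure of the selected blocks only for `t = 0`: the evaluation
functional `(w, b) ↦ ∑ w · feat - b` is an additive hom vanishing on the generators. [folklore] -/
theorem juntaSpan_sound {e : ℕ} {Idx : Type} [Fintype Idx] {m : ℕ} (feat : Idx → ZMod e)
    (R : Fin m → Set ((Idx → ZMod e) × ZMod e)) (v : Fin m → Bool)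
    (hR : ∀ j, v j = true → ∀ wb ∈ R j, ∑ ja, wb.1 ja * feat ja = wb.2) {t : ZMod e}
    (ht : ((0 : Idx → ZMod e), t) ∈ AddSubgroup.closure (⋃ j ∈ {j | v j = true}, R j)) :
    t = 0 := by
  -- the evaluation functional at `feat`
  let L : ((Idx → ZMod e) × ZMod e) →+ ZMod e :=
    { toFun := fun wb => ∑ ja, wb.1 ja * feat ja - wb.2
      map_zero' := by simp
      map_add' := fun a b => by
        simp only [Prod.fst_add, Prod.snd_add, Pi.add_apply, add_mul, Finset.sum_add_distrib]
        abel }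
  -- it kills every selected generator, hence the closure
  have hle : AddSubgroup.closure (⋃ j ∈ {j | v j = true}, R j) ≤ L.ker := by
    rw [AddSubgroup.closure_le]
    intro wb hwb
    simp only [Set.mem_iUnion, Set.mem_setOf_eq, exists_prop] at hwb
    obtain ⟨j, hj, hwb⟩ := hwb
    rw [SetLike.mem_coe, AddMonoidHom.mem_ker]
    show ∑ ja, wb.1 ja * feat ja - wb.2 = 0
    rw [hR j hj wb hwb, sub_self]
  have h0 := hle ht
  rw [AddMonoidHom.mem_ker] at h0
  change ∑ ja, (0 : Idx → ZMod e) ja * feat ja - t = 0 at h0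
  simpa using h0

/-- **Stub `stub_pGroupCaptureOfJuntaCompleteness`** (registered signature, proved exactly): completeness
of the scope-junta span program over `ℤ/|G|` for finite `p`-groups (the hypothesis) implies that every
`p`-group COSET gate of size parameter `s` is computed by a circuit of size `≤ (s + 2) ^ 4` over
`permBasis ((s + 2) ^ 4)` — soundness (`juntaSpan_sound`) + the hypothesis identify the gate with ONE ring
span program, compiled by `ring_span_program_cktSize`. [folklore] -/
theorem stub_pGroupCaptureOfJuntaCompleteness :
    (∀ (G : Type) [Group G] [Fintype G] [DecidableEq G], (∃ p : ℕ, p.Prime ∧ IsPGroup p G) →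
      ∀ (nv m : ℕ) (r : Fin m → ℕ) (scope : (j : Fin m) → Fin (r j) → Fin nv)
        (H : (j : Fin m) → Subgroup (Fin (r j) → G)) (c : (j : Fin m) → Fin (r j) → G) (v : Fin m → Bool),
        (¬ ∃ h : Fin nv → G, ∀ j, v j = true → (c j)⁻¹ * (fun i => h (scope j i)) ∈ H j) →
        ∃ t : ZMod (Fintype.card G), t ≠ 0 ∧
          ((0 : (Σ j : Fin m, (Fin (r j) → G)) → ZMod (Fintype.card G)), t) ∈
            AddSubgroup.closure (⋃ j ∈ {j : Fin m | v j = true},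
              {wb : ((Σ j : Fin m, (Fin (r j) → G)) → ZMod (Fintype.card G)) × ZMod (Fintype.card G) |
                ∀ h : Fin nv → G, (c j)⁻¹ * (fun i => h (scope j i)) ∈ H j →
                  ∑ ja : (Σ j' : Fin m, (Fin (r j') → G)),
                    wb.1 ja * (if (fun i => h (scope ja.1 i)) = ja.2 then 1 else 0) = wb.2})) →
    ∀ (s : ℕ) (g : GateFn), (g.1 ≤ s ∧ ∃ (G : Type) (_ : Group G) (_ : Fintype G) (nv : ℕ),
      (∃ p : ℕ, p.Prime ∧ IsPGroup p G) ∧ Fintype.card G ≤ s ∧ nv ≤ s ∧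
      ∃ (r : Fin g.1 → ℕ) (scope : (j : Fin g.1) → Fin (r j) → Fin nv)
        (H : (j : Fin g.1) → Subgroup (Fin (r j) → G)) (c : (j : Fin g.1) → Fin (r j) → G),
        (∀ j, Fintype.card G ^ r j ≤ s) ∧
        ∀ v : Fin g.1 → Bool, g.2 v = true ↔
          ¬ ∃ h : Fin nv → G, ∀ j, v j = true → (c j)⁻¹ * (fun i => h (scope j i)) ∈ H j) →
      ∃ C : Circuit (Fin g.1), C.IsOver (permBasis ((s + 2) ^ 4)) ∧ C.size ≤ (s + 2) ^ 4 ∧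
        C.Computes g.2 := by
  intro hJ s g hg
  obtain ⟨h1, G, iG, iF, nv, hp, hG, -, r, scope, H, c, hr, hiff⟩ := hg
  haveI : DecidableEq G := Classical.decEq G
  -- the relation blocks of the scope-junta span program (syntactically those of the hypothesis)
  let R : Fin g.1 →
      Set (((Σ j : Fin g.1, (Fin (r j) → G)) → ZMod (Fintype.card G)) × ZMod (Fintype.card G)) :=
    fun j => {wb | ∀ h : Fin nv → G, (c j)⁻¹ * (fun i => h (scope j i)) ∈ H j →
      ∑ ja : (Σ j' : Fin g.1, (Fin (r j') → G)),
        wb.1 ja * (if (fun i => h (scope ja.1 i)) = ja.2 then 1 else 0) = wb.2}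
  -- under the hypothesis the gate fires iff the ring span program accepts
  have key : ∀ v, g.2 v = true ↔ ∃ t : ZMod (Fintype.card G), t ≠ 0 ∧
      ((0 : (Σ j : Fin g.1, (Fin (r j) → G)) → ZMod (Fintype.card G)), t) ∈
        AddSubgroup.closure (⋃ j ∈ {j | v j = true}, R j) := by
    intro v
    rw [hiff v]
    constructor
    · intro hunsat
      exact hJ G hp nv g.1 r scope H c v hunsat
    · rintro ⟨t, ht, hmem⟩ ⟨h, hh⟩
      exact ht (juntaSpan_sound
        (fun ja : (Σ j : Fin g.1, (Fin (r j) → G)) =>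
          if (fun i => h (scope ja.1 i)) = ja.2 then (1 : ZMod (Fintype.card G)) else 0)
        R v (fun j hj wb hwb => hwb h (hh j hj)) hmem)
  -- size bookkeeping: `|G| (#features + 1) ≤ s (s² + 1) ≤ (s + 2)⁴`
  have hcard : Fintype.card (Σ j : Fin g.1, (Fin (r j) → G)) ≤ s * s := by
    rw [Fintype.card_sigma]
    calc ∑ j, Fintype.card (Fin (r j) → G) ≤ ∑ _j : Fin g.1, s :=
          Finset.sum_le_sum fun j _ => by rw [Fintype.card_fun, Fintype.card_fin]; exact hr j
      _ = g.1 * s := by rw [Finset.sum_const, Finset.card_univ, Fintype.card_fin, smul_eq_mul]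
      _ ≤ s * s := Nat.mul_le_mul_right s h1
  have hS : Fintype.card G * (Fintype.card (Σ j : Fin g.1, (Fin (r j) → G)) + 1) ≤ (s + 2) ^ 4 :=
    calc Fintype.card G * (Fintype.card (Σ j : Fin g.1, (Fin (r j) → G)) + 1) ≤ s * (s * s + 1) :=
          Nat.mul_le_mul hG (Nat.succ_le_succ hcard)
      _ ≤ (s + 2) ^ 4 := by nlinarith [Nat.zero_le (s ^ 4), Nat.zero_le (s ^ 3), Nat.zero_le (s ^ 2)]
  have hck := ring_span_program_cktSize (Fintype.card G) (Σ j : Fin g.1, (Fin (r j) → G)) g.1 R g.2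
    key ((s + 2) ^ 4) hS
  obtain ⟨C, hCB, hCs, hCe⟩ := hck.toCircuit
  refine ⟨C, hCB, hCs.trans ?_, fun x => hCe x⟩
  calc 2 * Fintype.card G + 1 ≤ 2 * s + 1 := by omega
    _ ≤ (s + 2) ^ 4 := by nlinarith [Nat.zero_le (s ^ 4), Nat.zero_le (s ^ 3), Nat.zero_le (s ^ 2)]

end Summit.PneNP.PneNP.Cruxes.Capture.CspSpineMeetToJoin
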